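import Literature.Computability.Complexity.HardcoreInapproximabilityCycles
import HarnessLib

/-!
# Short cycles of Sly's random bipartite core, II: the dihedral action on rooted cycles

Allan Sly, *Computational transition at the uniqueness threshold*, FOCS 2010 (arXiv:1005.5584), §3.2
(Lemma 3.7, after MWW09 Lemma 7.3).

`HardcoreInapproximabilityCycles` counts ROOTED ORIENTED coloured `2j`-cycles (`SlyWCycle`,
`slyRootedCycles = R_{2j}`), while Sly's `X_{2j}` counts cycles as subgraphs. This file supplies the
passage between the two without quotient types: the explicit dihedral action on `SlyWCycle n q j`
(`SlyWCycle.rotate` — move the root one step; `SlyWCycle.reflect` — reverse the orientation), its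
relations (`iterate_rotate_self`: `rot^j = id`; `reflect_reflect`; `rotate_reflect` /
`reflect_rotate`: `rot ∘ refl = refl ∘ rot^{j-1}`), its FREENESS (`iterate_rotate_injective`,
`iterate_rotate_ne_reflect`), invariance of presence (`present_rotate`, `present_reflect`), and the
set `SlyWCycle.reps C` of the `2j` representatives of the cycle underlying `C` (`card_reps`,
`reps_eq_of_mem_reps`: `reps` is a class function, so "same underlying cycle" is the equivalence
relation `C.reps = D.reps` with classes of size exactly `2j`; hence `R_{2j} = 2j · X_{2j}` on every
realisation and `(2j)^m (X_{2j})_m` counts ordered `m`-tuples of present rooted cycles with pairwise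
distinct `reps`). [cite: Sly2010, Lemma 3.7]
-/

namespace Literature.Computability.Complexity

open Finset

section Dihedral

variable {n m' q j : ℕ}

/-- `rot (rev (rot t)) = rev t` in `Fin j`. [folklore] -/
theorem finRotate_rev_finRotate (t : Fin j) : finRotate j (Fin.rev (finRotate j t)) = Fin.rev t := by
  have ht := t.isLt
  apply Fin.ext
  simp only [finRotate_apply, Fin.val_add, Fin.val_rev, Fin.val_one']
  rcases Nat.lt_or_ge 1 j with h1 | h1
  · rw [Nat.mod_eq_of_lt h1]
    rcases Nat.lt_or_ge ((t : ℕ) + 1) j with h | h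
    · rw [Nat.mod_eq_of_lt h, Nat.mod_eq_of_lt (by omega)]; omega
    · rw [show (t : ℕ) + 1 = j by omega, Nat.mod_self, show j - (0 + 1) + 1 = j by omega, Nat.mod_self]; omega
  · have hj1 : j = 1 := by omega
    subst hj1
    simp

/-- **Re-rooting**: move the root one step along the cycle. [folklore] -/
def SlyWCycle.rotate (C : SlyWCycle n q j) : SlyWCycle n q j where
  v := C.v ∘ finRotate j
  w := C.w ∘ finRotate j
  a := C.a ∘ finRotate j
  b := C.b ∘ finRotate j
  hv := C.hv.comp (finRotate j).injective
  hw := C.hw.comp (finRotate j).injective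
  hab _ := C.hab _
  hba _ := C.hba _

/-- **Reversing the orientation** (keeping the root): `v'_t = v_{-t}`, `w'_t = w_{-t-1}`,
`a'_t = b_{-t-1}`, `b'_t = a_{-t-1}` (written with `Fin.rev`: `-t-1 = rev t`). [folklore] -/
def SlyWCycle.reflect (C : SlyWCycle n q j) : SlyWCycle n q j where
  v t := C.v (finRotate j (Fin.rev t))
  w t := C.w (Fin.rev t)
  a t := C.b (Fin.rev t)
  b t := C.a (Fin.rev t)
  hv := C.hv.comp ((finRotate j).injective.comp Fin.rev_injective)
  hw := C.hw.comp Fin.rev_injective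
  hab t := (C.hab (Fin.rev t)).symm
  hba t := by
    -- `a (rev t) ≠ b (rev (t+1))`, and `rot (rev (t+1)) = rev t`
    intro h
    have e := finRotate_rev_finRotate t
    apply C.hba (Fin.rev (finRotate j t))
    rw [e]
    exact h.symm

/-- Presence is invariant under re-rooting. [folklore] -/
theorem SlyWCycle.present_rotate (C : SlyWCycle n q j) (σ : Fin q → Equiv.Perm (Fin (n + m'))) (τ : Equiv.Perm (Fin n)) :
    C.rotate.Present σ τ ↔ C.Present σ τ := by
  unfold Present rotate
  simp only [Function.comp]
  constructor
  · rintro ⟨h1, h2⟩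
    refine ⟨fun t => ?_, fun t => ?_⟩
    · have := h1 ((finRotate j).symm t); rwa [Equiv.apply_symm_apply] at this
    · have := h2 ((finRotate j).symm t); rwa [Equiv.apply_symm_apply] at this
  · rintro ⟨h1, h2⟩
    exact ⟨fun t => h1 _, fun t => h2 _⟩

/-- Presence is invariant under reversing the orientation. [folklore] -/
theorem SlyWCycle.present_reflect (C : SlyWCycle n q j) (σ : Fin q → Equiv.Perm (Fin (n + m'))) (τ : Equiv.Perm (Fin n)) :
    C.reflect.Present σ τ ↔ C.Present σ τ := by
  unfold Present reflect
  simp only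
  constructor
  · rintro ⟨h1, h2⟩
    refine ⟨fun t => ?_, fun t => ?_⟩
    · have := h2 (Fin.rev t)
      rw [finRotate_rev_finRotate, Fin.rev_rev] at this
      exact this
    · have := h1 (Fin.rev t)
      rw [Fin.rev_rev] at this
      exact this
  · rintro ⟨h1, h2⟩
    refine ⟨fun t => ?_, fun t => ?_⟩
    · exact h2 (Fin.rev t)
    · have := h1 (Fin.rev t)
      rw [finRotate_rev_finRotate]
      exact this

end Dihedral

section Orbits

variable {n m' q j : ℕ}

/-- `rot^s t = t + s (mod j)`. [folklore] -/
theorem iterate_finRotate_val (s : ℕ) (t : Fin j) : (((finRotate j)^[s] t : Fin j) : ℕ) = ((t : ℕ) + s) % j := by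
  have ht := t.isLt
  induction s with
  | zero => simp [Nat.mod_eq_of_lt ht]
  | succ s ih =>
    rw [Function.iterate_succ_apply', finRotate_apply, Fin.val_add, ih, Fin.val_one']
    rcases Nat.lt_or_ge 1 j with h1 | h1
    · rw [Nat.mod_eq_of_lt h1, Nat.add_mod, Nat.mod_mod, ← Nat.add_mod, Nat.add_assoc]
    · have hj1 : j = 1 := by omega
      subst hj1; simp

/-- The `v`-sequence of an iterated re-rooting. [folklore] -/
theorem SlyWCycle.iterate_rotate_v (C : SlyWCycle n q j) (s : ℕ) : (SlyWCycle.rotate^[s] C).v = C.v ∘ (finRotate j)^[s] := by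
  induction s generalizing C with
  | zero => rfl
  | succ s ih =>
    rw [Function.iterate_succ_apply, ih, Function.iterate_succ']
    rfl

/-- The `w`-sequence of an iterated re-rooting. [folklore] -/
theorem SlyWCycle.iterate_rotate_w (C : SlyWCycle n q j) (s : ℕ) : (SlyWCycle.rotate^[s] C).w = C.w ∘ (finRotate j)^[s] := by
  induction s generalizing C with
  | zero => rfl
  | succ s ih =>
    rw [Function.iterate_succ_apply, ih, Function.iterate_succ']
    rfl

/-- **Re-rooting is free**: distinct rotation amounts `s ≠ s' < j` give distinct rooted cycles. [folklore] -/
theorem SlyWCycle.iterate_rotate_injective (C : SlyWCycle n q j) {s s' : ℕ} (hs : s < j) (hs' : s' < j)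
    (h : SlyWCycle.rotate^[s] C = SlyWCycle.rotate^[s'] C) : s = s' := by
  have hv := congrArg SlyWCycle.v h
  rw [C.iterate_rotate_v, C.iterate_rotate_v] at hv
  have h0 := congrFun hv ⟨0, by omega⟩
  simp only [Function.comp] at h0
  have h1 := congrArg Fin.val (C.hv h0)
  rw [iterate_finRotate_val, iterate_finRotate_val] at h1
  simp only [Nat.zero_add, Nat.mod_eq_of_lt hs, Nat.mod_eq_of_lt hs'] at h1
  exact h1

/-- Presence is invariant under iterated re-rooting. [folklore] -/
theorem SlyWCycle.present_iterate_rotate (C : SlyWCycle n q j) (σ : Fin q → Equiv.Perm (Fin (n + m'))) (τ : Equiv.Perm (Fin n)) (s : ℕ) :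
    (SlyWCycle.rotate^[s] C).Present σ τ ↔ C.Present σ τ := by
  induction s generalizing C with
  | zero => exact Iff.rfl
  | succ s ih => rw [Function.iterate_succ_apply, ih, SlyWCycle.present_rotate]

/-- **Rotations never produce the reflection**: `rot^s C ≠ rot^{s'} (reflect C)` (`j ≥ 1`). [folklore] -/
theorem SlyWCycle.iterate_rotate_ne_reflect (hj : 0 < j) (C : SlyWCycle n q j) (s s' : ℕ) :
    SlyWCycle.rotate^[s] C ≠ SlyWCycle.rotate^[s'] C.reflect := by
  intro h
  have hv := congrArg SlyWCycle.v h
  have hw := congrArg SlyWCycle.w h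
  rw [C.iterate_rotate_v, C.reflect.iterate_rotate_v] at hv
  rw [C.iterate_rotate_w, C.reflect.iterate_rotate_w] at hw
  have hv' : ∀ t, (finRotate j)^[s] t = finRotate j (Fin.rev ((finRotate j)^[s'] t)) := by
    intro t
    have := congrFun hv t
    simp only [Function.comp, SlyWCycle.reflect] at this
    exact C.hv this
  have hw' : ∀ t, (finRotate j)^[s] t = Fin.rev ((finRotate j)^[s'] t) := by
    intro t
    have := congrFun hw t
    simp only [Function.comp, SlyWCycle.reflect] at this
    exact C.hw this
  -- hence `rot (rev u) = rev u` for every `u`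
  have key : ∀ u : Fin j, finRotate j (Fin.rev u) = Fin.rev u := by
    intro u
    obtain ⟨t, rfl⟩ : ∃ t, (finRotate j)^[s'] t = u := (Function.Surjective.iterate (finRotate j).surjective s') u
    rw [← hv' t, hw' t]
  have h0 := congrArg Fin.val (key (Fin.rev ⟨0, hj⟩))
  rw [Fin.rev_rev, finRotate_apply, Fin.val_add, Fin.val_one'] at h0
  rcases Nat.lt_or_ge 1 j with h1 | h1
  · rw [Nat.mod_eq_of_lt h1, Nat.zero_add, Nat.mod_eq_of_lt h1] at h0
    exact absurd h0 (by norm_num)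
  · -- `j = 1`: compare the colours at `0`
    have hj1 : j = 1 := by omega
    subst hj1
    have ha := congrArg SlyWCycle.a h
    have hrot : ∀ (D : SlyWCycle n q 1) (r : ℕ), (SlyWCycle.rotate^[r] D).a = D.a := by
      intro D r
      induction r generalizing D with
      | zero => rfl
      | succ r ih =>
        rw [Function.iterate_succ_apply, ih]
        funext t
        show D.a (finRotate 1 t) = D.a t
        rw [Subsingleton.elim (finRotate 1 t) t]
    rw [hrot, hrot] at ha
    have := congrFun ha 0
    simp only [SlyWCycle.reflect] at this
    exact C.hab 0 (by rw [this, Subsingleton.elim (Fin.rev (0 : Fin 1)) 0])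

/-- A full turn is the identity: `rot^j = id`. [folklore] -/
theorem iterate_finRotate_self (t : Fin j) : (finRotate j)^[j] t = t := by
  apply Fin.ext
  rw [iterate_finRotate_val, Nat.add_mod_right, Nat.mod_eq_of_lt t.isLt]

/-- `rev (rot t) = rot^{j-1} (rev t)`. [folklore] -/
theorem rev_finRotate (t : Fin j) : Fin.rev (finRotate j t) = (finRotate j)^[j - 1] (Fin.rev t) := by
  have ht := t.isLt
  apply Fin.ext
  rw [iterate_finRotate_val, Fin.val_rev, Fin.val_rev, finRotate_apply, Fin.val_add, Fin.val_one']
  rcases Nat.lt_or_ge 1 j with h1 | h1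
  · rw [Nat.mod_eq_of_lt h1]
    rcases Nat.lt_or_ge ((t : ℕ) + 1) j with h | h
    · rw [Nat.mod_eq_of_lt h, show j - ((t : ℕ) + 1) + (j - 1) = (j - ((t : ℕ) + 1) - 1) + j by omega, Nat.add_mod_right,
        Nat.mod_eq_of_lt (by omega)]
      omega
    · rw [show (t : ℕ) + 1 = j by omega, Nat.mod_self, show j - j + (j - 1) = j - 1 by omega, Nat.mod_eq_of_lt (by omega)]
  · have hj1 : j = 1 := by omega
    subst hj1; simp

/-- Extensionality for rooted cycles on the data fields. [folklore] -/
theorem SlyWCycle.ext' {C D : SlyWCycle n q j} (hv : C.v = D.v) (hw : C.w = D.w) (ha : C.a = D.a) (hb : C.b = D.b) : C = D := by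
  cases C; cases D
  simp only at hv hw ha hb
  subst hv; subst hw; subst ha; subst hb
  rfl

/-- The `a`-colours of an iterated re-rooting. [folklore] -/
theorem SlyWCycle.iterate_rotate_a (C : SlyWCycle n q j) (s : ℕ) : (SlyWCycle.rotate^[s] C).a = C.a ∘ (finRotate j)^[s] := by
  induction s generalizing C with
  | zero => rfl
  | succ s ih =>
    rw [Function.iterate_succ_apply, ih, Function.iterate_succ']
    rfl

/-- The `b`-colours of an iterated re-rooting. [folklore] -/
theorem SlyWCycle.iterate_rotate_b (C : SlyWCycle n q j) (s : ℕ) : (SlyWCycle.rotate^[s] C).b = C.b ∘ (finRotate j)^[s] := by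
  induction s generalizing C with
  | zero => rfl
  | succ s ih =>
    rw [Function.iterate_succ_apply, ih, Function.iterate_succ']
    rfl

/-- A full turn of re-rootings is the identity. [folklore] -/
theorem SlyWCycle.iterate_rotate_self (C : SlyWCycle n q j) : SlyWCycle.rotate^[j] C = C := by
  apply SlyWCycle.ext'
  · rw [C.iterate_rotate_v]; funext t; simp [iterate_finRotate_self]
  · rw [C.iterate_rotate_w]; funext t; simp [iterate_finRotate_self]
  · rw [C.iterate_rotate_a]; funext t; simp [iterate_finRotate_self]
  · rw [C.iterate_rotate_b]; funext t; simp [iterate_finRotate_self]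

/-- Reversing twice is the identity. [folklore] -/
theorem SlyWCycle.reflect_reflect (C : SlyWCycle n q j) : C.reflect.reflect = C := by
  apply SlyWCycle.ext' <;> funext t
  · show C.v (finRotate j (Fin.rev (finRotate j (Fin.rev t)))) = C.v t
    rw [finRotate_rev_finRotate, Fin.rev_rev]
  · show C.w (Fin.rev (Fin.rev t)) = C.w t
    rw [Fin.rev_rev]
  · show C.a (Fin.rev (Fin.rev t)) = C.a t
    rw [Fin.rev_rev]
  · show C.b (Fin.rev (Fin.rev t)) = C.b t
    rw [Fin.rev_rev]

/-- **The dihedral relation** `rot ∘ refl = refl ∘ rot^{j-1}` on rooted cycles. [folklore] -/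
theorem SlyWCycle.rotate_reflect (C : SlyWCycle n q j) : C.reflect.rotate = (SlyWCycle.rotate^[j - 1] C).reflect := by
  rcases Nat.eq_zero_or_pos j with hj | hj
  · subst hj
    apply SlyWCycle.ext' <;> funext t <;> exact t.elim0
  have hrot : ∀ x : Fin j, (finRotate j)^[j - 1] (finRotate j x) = x := fun x => by
    rw [← Function.iterate_succ_apply, show (j - 1).succ = j by omega, iterate_finRotate_self]
  apply SlyWCycle.ext' <;> funext t
  · show C.v (finRotate j (Fin.rev (finRotate j t))) = (SlyWCycle.rotate^[j - 1] C).v (finRotate j (Fin.rev t))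
    rw [C.iterate_rotate_v, Function.comp_apply, hrot, finRotate_rev_finRotate]
  · show C.w (Fin.rev (finRotate j t)) = (SlyWCycle.rotate^[j - 1] C).w (Fin.rev t)
    rw [C.iterate_rotate_w, Function.comp_apply, rev_finRotate]
  · show C.b (Fin.rev (finRotate j t)) = (SlyWCycle.rotate^[j - 1] C).b (Fin.rev t)
    rw [C.iterate_rotate_b, Function.comp_apply, rev_finRotate]
  · show C.a (Fin.rev (finRotate j t)) = (SlyWCycle.rotate^[j - 1] C).a (Fin.rev t)
    rw [C.iterate_rotate_a, Function.comp_apply, rev_finRotate]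

/-- Exponents of re-rootings only matter modulo `j`. [folklore] -/
theorem SlyWCycle.iterate_rotate_mod (C : SlyWCycle n q j) (s : ℕ) : SlyWCycle.rotate^[s] C = SlyWCycle.rotate^[s % j] C := by
  conv_lhs => rw [← Nat.mod_add_div s j, Function.iterate_add_apply]
  congr 1
  induction s / j with
  | zero => rfl
  | succ k ih => rw [Nat.mul_succ, Function.iterate_add_apply, C.iterate_rotate_self, ih]

/-- `rot^k ∘ refl = refl ∘ rot^{k(j-1)}`. [folklore] -/
theorem SlyWCycle.iterate_rotate_reflect (C : SlyWCycle n q j) (k : ℕ) :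
    SlyWCycle.rotate^[k] C.reflect = (SlyWCycle.rotate^[k * (j - 1)] C).reflect := by
  induction k generalizing C with
  | zero => simp
  | succ k ih =>
    rw [Function.iterate_succ_apply, C.rotate_reflect, ih, Nat.succ_mul, Function.iterate_add_apply]

/-- `refl ∘ rot = rot^{j-1} ∘ refl`. [folklore] -/
theorem SlyWCycle.reflect_rotate (hj : 0 < j) (C : SlyWCycle n q j) :
    C.rotate.reflect = SlyWCycle.rotate^[j - 1] C.reflect := by
  rw [C.iterate_rotate_reflect (j - 1), C.iterate_rotate_mod ((j - 1) * (j - 1))]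
  congr 2
  -- `(j-1)² ≡ 1 (mod j)` and `rot^1 = rotate`
  have h : (j - 1) * (j - 1) % j = 1 % j := by
    rcases Nat.lt_or_ge 1 j with h1 | h1
    · have : (j - 1) * (j - 1) = (j - 2) * j + 1 := by
        obtain ⟨k, rfl⟩ : ∃ k, j = k + 2 := ⟨j - 2, by omega⟩
        simp; ring
      rw [this, Nat.mul_comm, Nat.mul_add_mod]
    · have : j = 1 := by omega
      subst this; simp
  rw [h]
  rcases Nat.lt_or_ge 1 j with h1 | h1
  · rw [Nat.mod_eq_of_lt h1]; rfl
  · have : j = 1 := by omega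
    subst this
    show C.rotate = SlyWCycle.rotate^[0] C
    rw [Function.iterate_zero_apply]
    have := C.iterate_rotate_self
    rwa [Function.iterate_one] at this

open scoped Classical in
/-- **The `2j` rooted oriented representatives of a cycle**: all `rot^s (refl^e C)`. [folklore] -/
noncomputable def SlyWCycle.reps (C : SlyWCycle n q j) : Finset (SlyWCycle n q j) :=
  (univ : Finset (Fin j × Bool)).image fun p => SlyWCycle.rotate^[p.1] (bif p.2 then C.reflect else C)

open scoped Classical in
/-- Membership in the set of representatives. [folklore] -/
theorem SlyWCycle.mem_reps {C D : SlyWCycle n q j} :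
    D ∈ C.reps ↔ ∃ (s : Fin j) (e : Bool), D = SlyWCycle.rotate^[s] (bif e then C.reflect else C) := by
  unfold reps
  simp only [Finset.mem_image, Finset.mem_univ, true_and, Prod.exists]
  constructor
  · rintro ⟨s, e, h⟩; exact ⟨s, e, h.symm⟩
  · rintro ⟨s, e, h⟩; exact ⟨s, e, h.symm⟩

open scoped Classical in
/-- **Each cycle has exactly `2j` rooted oriented representatives** (the dihedral action is free). [folklore] -/
theorem SlyWCycle.card_reps (hj : 0 < j) (C : SlyWCycle n q j) : C.reps.card = 2 * j := by
  unfold reps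
  rw [Finset.card_image_of_injective, Finset.card_univ, Fintype.card_prod, Fintype.card_fin, Fintype.card_bool, Nat.mul_comm]
  rintro ⟨s, e⟩ ⟨s', e'⟩ h
  simp only at h
  cases e <;> cases e' <;> simp only [cond_true, cond_false] at h
  · exact Prod.ext (Fin.ext (C.iterate_rotate_injective s.isLt s'.isLt h)) rfl
  · exact absurd h (C.iterate_rotate_ne_reflect hj s s')
  · exact absurd h.symm (C.iterate_rotate_ne_reflect hj s' s)
  · exact Prod.ext (Fin.ext (C.reflect.iterate_rotate_injective s.isLt s'.isLt h)) rfl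

/-- A cycle is one of its own representatives. [folklore] -/
theorem SlyWCycle.self_mem_reps (hj : 0 < j) (C : SlyWCycle n q j) : C ∈ C.reps :=
  SlyWCycle.mem_reps.2 ⟨⟨0, hj⟩, false, rfl⟩

/-- Presence is constant on the representatives. [folklore] -/
theorem SlyWCycle.present_of_mem_reps {C D : SlyWCycle n q j} (h : D ∈ C.reps)
    (σ : Fin q → Equiv.Perm (Fin (n + m'))) (τ : Equiv.Perm (Fin n)) : D.Present σ τ ↔ C.Present σ τ := by
  obtain ⟨s, e, rfl⟩ := SlyWCycle.mem_reps.1 h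
  rw [SlyWCycle.present_iterate_rotate]
  cases e
  · exact Iff.rfl
  · exact C.present_reflect σ τ

/-- The representatives of a re-rooting are the same. [folklore] -/
theorem SlyWCycle.reps_rotate (hj : 0 < j) (C : SlyWCycle n q j) : C.rotate.reps = C.reps := by
  classical
  apply Finset.eq_of_subset_of_card_le
  · intro D hD
    obtain ⟨s, e, rfl⟩ := SlyWCycle.mem_reps.1 hD
    rw [SlyWCycle.mem_reps]
    cases e
    · refine ⟨⟨((s : ℕ) + 1) % j, Nat.mod_lt _ hj⟩, false, ?_⟩
      simp only [cond_false]
      rw [← C.iterate_rotate_mod, Function.iterate_succ_apply]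
    · refine ⟨⟨((s : ℕ) + (j - 1)) % j, Nat.mod_lt _ hj⟩, true, ?_⟩
      simp only [cond_true]
      rw [← C.reflect.iterate_rotate_mod, Function.iterate_add_apply, ← C.reflect_rotate hj]
  · rw [C.card_reps hj, C.rotate.card_reps hj]

/-- The representatives of the reversed cycle are the same. [folklore] -/
theorem SlyWCycle.reps_reflect (hj : 0 < j) (C : SlyWCycle n q j) : C.reflect.reps = C.reps := by
  classical
  apply Finset.eq_of_subset_of_card_le
  · intro D hD
    obtain ⟨s, e, rfl⟩ := SlyWCycle.mem_reps.1 hD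
    rw [SlyWCycle.mem_reps]
    cases e
    · exact ⟨s, true, rfl⟩
    · exact ⟨s, false, by simp only [cond_true, cond_false, C.reflect_reflect]⟩
  · rw [C.card_reps hj, C.reflect.card_reps hj]

/-- **`reps` is a class function**: representatives of a representative are the same set. [folklore] -/
theorem SlyWCycle.reps_eq_of_mem_reps (hj : 0 < j) {C D : SlyWCycle n q j} (h : D ∈ C.reps) : D.reps = C.reps := by
  obtain ⟨s, e, rfl⟩ := SlyWCycle.mem_reps.1 h
  have hrot : ∀ (k : ℕ) (E : SlyWCycle n q j), (SlyWCycle.rotate^[k] E).reps = E.reps := by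
    intro k E
    induction k generalizing E with
    | zero => rfl
    | succ k ih => rw [Function.iterate_succ_apply, ih, E.reps_rotate hj]
  rw [hrot]
  cases e
  · rfl
  · exact C.reps_reflect hj

end Orbits

end Literature.Computability.Complexity
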